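import Summits.Ventures.Crystal3D.Theorems.StickyWulffConstantTextureLiminfTexShadowDefs

/-!
# `PolycrystalWulffBound`: clause (B) of `PolytopeCalculus` on an arbitrary SUB-FAMILY of cells

Route `StickyWulffConstant` of the venture `Summits/Ventures/Crystal3D`, crux `PolycrystalWulffBound`
(item `stmt-Ventures-19482`), second prover lane; step 4(a) of the P-BRIDGE memo (evidence #10 on the
item).  Clause (B) of the registered stub statement `PolytopeCalculus` (line TexShadow, 19483) is
stated for `Fin k`-indexed families.  A texture refined over ONE arrangement
(`exists_disjoint_polytope_refinement_full`) needs it for the cells of EACH GRAIN, i.e. for a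
sub-family `s : Finset (Fin k)`.  Re-indexing by the ORDER-PRESERVING enumeration
`s.orderEmbOfFin` transports hypotheses and conclusion verbatim (the `i < j` condition included), so:

* `per_biUnion_eq_of_polytopeCalculus` — `PolytopeCalculus →` for every family `(H, ν)` satisfying
  clause (B)'s hypotheses on `Fin k` and every `s : Finset (Fin k)`:
  `per K (⋃ j ∈ s, polytope (H j)) = Σ_{j ∈ s} per K (polytope (H j))
     − Σ_{a ∈ s} Σ_{b ∈ s} [a < b] (h_K(ν a b) + h_K(−ν a b)) · facetArea (Q̄_a ∩ Q̄_b) (ν a b)`.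
Conditional only on the registered stub BY NAME.  WHAT THIS IS NOT: the facet calculus itself; the
interface formula `ι_K(G_f, G_g)` = cross-cell sum (step 4(b), pure Finset algebra on top of this).
-/

noncomputable section

namespace Summit.Ventures.Crystal3D.Theorems

open MeasureTheory Set
open scoped RealInnerProductSpace ENNReal
open Summit.Ventures.Crystal3D.Cruxes.TextureLiminf.TexShadow

/-- **Clause (B) on a sub-family.** Assuming `PolytopeCalculus`: for bounded, pairwise disjoint open
polytopes `polytope (H j)`, `j : Fin k`, with unit common-plane normals `ν`, and ANY `s : Finset (Fin k)`,
the `K`-perimeter of `⋃_{j ∈ s} polytope (H j)` is the sum of the cells' perimeters minus the cross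
terms over pairs `a < b` in `s`. -/
theorem per_biUnion_eq_of_polytopeCalculus (hPC : PolytopeCalculus) {K : Set E3}
    (hK : IsCompact K) (hKc : Convex ℝ K) (h0 : (0 : E3) ∈ K) {k : ℕ}
    (H : Fin k → Finset (E3 × ℝ)) (ν : Fin k → Fin k → E3)
    (hbd : ∀ j, Bornology.IsBounded (polytope (H j)))
    (hdisj : ∀ j j', j ≠ j' → Disjoint (polytope (H j)) (polytope (H j')))
    (hplane : ∀ j j', j ≠ j' → ‖ν j j'‖ = 1 ∧ ∃ b : ℝ,
      closure (polytope (H j)) ∩ closure (polytope (H j')) ⊆ {x | ⟪ν j j', x⟫ = b})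
    (s : Finset (Fin k)) :
    per K (⋃ j ∈ s, polytope (H j)) = ∑ j ∈ s, per K (polytope (H j)) -
      ∑ a ∈ s, ∑ b ∈ s, (if a < b then (supportFn K (ν a b) + supportFn K (-ν a b)) *
        facetArea (closure (polytope (H a)) ∩ closure (polytope (H b))) (ν a b) else 0) := by
  -- order-preserving enumeration of `s`
  set m : ℕ := s.card with hm
  set e : Fin m ↪o Fin k := s.orderEmbOfFin rfl with he
  have he_mem : ∀ i, e i ∈ s := fun i => by
    have : e i ∈ Set.range e := ⟨i, rfl⟩
    rw [he, Finset.range_orderEmbOfFin] at this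
    exact this
  have he_surj : ∀ j ∈ s, ∃ i, e i = j := fun j hj => by
    have : j ∈ Set.range e := by rw [he, Finset.range_orderEmbOfFin]; exact hj
    exact this
  have he_inj : Function.Injective e := e.injective
  have hmap : (Finset.univ : Finset (Fin m)).map e.toEmbedding = s := by
    ext j
    simp only [Finset.mem_map, Finset.mem_univ, true_and]
    constructor
    · rintro ⟨i, rfl⟩; exact he_mem i
    · intro hj
      obtain ⟨i, hi⟩ := he_surj j hj
      exact ⟨i, hi⟩
  -- clause (B) for the re-indexed family
  obtain ⟨-, hB⟩ := hPC K hK hKc h0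
  have hB' := hB m (fun i => H (e i)) (fun i i' => ν (e i) (e i')) (fun i => hbd (e i))
    (fun i i' hii' => hdisj _ _ (fun h => hii' (he_inj h)))
    (fun i i' hii' => hplane _ _ (fun h => hii' (he_inj h)))
  -- identify the union
  have hU : (⋃ i, polytope (H (e i))) = ⋃ j ∈ s, polytope (H j) := by
    ext x
    simp only [mem_iUnion]
    constructor
    · rintro ⟨i, hx⟩; exact ⟨e i, he_mem i, hx⟩
    · rintro ⟨j, hj, hx⟩
      obtain ⟨i, rfl⟩ := he_surj j hj
      exact ⟨i, hx⟩
  -- identify the single sum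
  have hS1 : (∑ i, per K (polytope (H (e i)))) = ∑ j ∈ s, per K (polytope (H j)) := by
    rw [← hmap, Finset.sum_map]
    rfl
  -- identify the double sum (order-preserving: `i < i' ↔ e i < e i'`)
  have hS2 : (∑ i, ∑ i', (if i < i' then (supportFn K (ν (e i) (e i')) + supportFn K (-ν (e i) (e i'))) *
        facetArea (closure (polytope (H (e i))) ∩ closure (polytope (H (e i')))) (ν (e i) (e i'))
        else 0)) =
      ∑ a ∈ s, ∑ b ∈ s, (if a < b then (supportFn K (ν a b) + supportFn K (-ν a b)) *
        facetArea (closure (polytope (H a)) ∩ closure (polytope (H b))) (ν a b) else 0) := by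
    rw [← hmap, Finset.sum_map]
    refine Finset.sum_congr rfl fun i _ => ?_
    rw [Finset.sum_map]
    refine Finset.sum_congr rfl fun i' _ => ?_
    have hlt : (i < i') ↔ (e.toEmbedding i < e.toEmbedding i') := (e.lt_iff_lt).symm
    by_cases h : i < i'
    · rw [if_pos h, if_pos (hlt.1 h)]; rfl
    · rw [if_neg h, if_neg (fun h' => h (hlt.2 h'))]
  rw [← hU, ← hS1, ← hS2]
  exact hB'

end Summit.Ventures.Crystal3D.Theorems

end
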